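import Summits.QuantumFields.YangMills.Theorems.UnitScaleTiltProp7SectET3ClassTransferZd
import Summits.QuantumFields.YangMills.Theorems.UnitScaleTiltProp7SectET3BgClass
import Literature.MathematicalPhysics.QuantumFieldTheory.Balaban1983to89.B8Thm2SetupTorus
import Literature.MathematicalPhysics.QuantumFieldTheory.Balaban1983to89.T3PrintedRegularMinimiser
import HarnessLib

/-!
# Route `UnitScaleTilt`, crux «MinimiserStabilityRegPr» (stmt-QuantumFields-19200, EX) ∕ deciding crux 20520 — item I-07 of `pub/ym-inputs/INPUT-LIST.md`:
# **THE T³ KNIT OF THE CLASS-TRANSFER ROW «𝔘_k(α₀) ⊂ (3.35) ∧ (3.36)» ([Balaban1985RegularSpaces] (1.33) second clause = Prop. 6) AT THE MEMBER OF RECORD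
# `Prop7SectET3Members.memberIdx`, FROM PROPOSITION 6 AS PRINTED — in the PRINT-FAITHFUL SHAPE `M·α₀ ≤ a₅` (flag (F1) of the desk's LOCATE memo)**

Cell `ym-inputs` (desk ym-inputs-plan-1, seat ym-inputs-p06), HUMAN RULING D-0037: YM₃ on T³ is ladder rung R3 — NOT the Clay problem.  Count-neutral helper
(`--supports stmt-QuantumFields-20520 --as helper`); THEOREMS ONLY (0 `def`, 0 `sorry`, 0 `instance`); nothing of [Balaban1985RegularSpaces] ∕
[Balaban1985BackgroundPropagators] is asserted — Proposition 6 is CONSUMED BY NAME through the companion `…Prop7SectET3ClassTransferZd` (pub-ymgap N05 lineage's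
`prop6Printed_zdCubP_γ_holds`).

THE ROW AND ITS CONSUMERS.  `Prop7SectET3BgClass.ClassTransferT3 ℓ hL c35` (★w1-20520 g2; `hCT` of `Prop7SectET3NormG.normG_row_of_t313_classTransfer` :141 and of the
`norm_H₁`∕`norm_H` twins) asks (3.35) ∧ (3.36) of [4] at EVERY `α₀ = L³B₃ε₁ > 0`; print ([B8] Prop. 6 p.99 «for α₀ sufficiently small») and the engine give it for
`M·α₀` below a threshold — and every consumer reads the row ONLY at `α = a₀ ∕ M` (`…SectET3NormG.lean:159–170`).  THIS FILE proves the row's BODY in that print-faithful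
shape, as a bare theorem (def-free seat), so that the re-typed row the cell's OWNER words is discharged by `exact`:
★★★ `reg335_reg336_T3_of_regPr` — for odd `L = ℓ + 1 ≥ 5`: `∃ c35 a₅ > 0, ∀ member (hℓ m hm n K a' R hk1 hsize hM8 hR2), ∀ α₀ > 0, (L·L^{a'})·α₀ ≤ a₅ →
∀ U₀ ∈ RegPr ⟨ℓ+1, hL, m, hm⟩ n K α₀, ∀ c ≥ c35, (bgT3 (memberIdx …)).Reg335 c α₀ (cfgV1OfT3 U₀) ∧ (bgT3 (memberIdx …)).Reg336 c α₀ (cfgV1OfT3 U₀)`.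

ROUTE OF THE PROOF (the desk's (R1)–(R3), all BY NAME).  (R1) `U₀ ∈ 𝔘_{K−n}(α₀)` on the member torus ⟹ the periodic pullback `W = pull (unitsField (toUField U₀)) 0`
lies in `𝔄_{K−n}(ℤ³, α₀)` (`T3PrintedRegularMinimiser.regPr_iff_inSpace` ∘ `B8Thm2SetupTorus.inSpace_univ_iff_inAk_pull`); (R2) the member's cube class
(`B9BackgroundsKLevelV1.cubeClass396 (memberIdx …)`) has ONE index `j = K − n` (the padded top level is empty: `levV1_memberIdx`), its cubes are torus cubes
`torusCube c (n'·bigSide)` whose lifts `boxZd c♯ (n'·bigSide)` are p. 396 class cubes of the all-torus `ℤ³` datum (`IsCube396Zd (L·L^{a'}) L (K−n)`); (R3) the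
companion's `reg336Cube_zd_of_inAk` gives (3.35)–(3.36) on the lift at scale `L^{K−n}·L^{−(K−n)} = 1`, and §1's DESCENT (`reg336Cube_torus_of_pull`: the gauge and the
one-form read through `x ↦ c♯ + rel c x`, no wrap-around on the ±1 stencil since `2·side + 2 ≤ 2L^{m+K}`) returns it to the torus cube in def-Y's letters
(`shiftsV1`, `cfgV1OfT3`).

WHAT IS PROVED.  §1 generic torus ↔ `ℤᵈ` bookkeeping (`transl_zero_lift`, `rel_eq_val_of_lt`, `rel_unshift_of_lt`, the flat-operator transport lemmas
`covD_one_comp` ∕ `curlη_one_comp` ∕ `divPη_curlη_one_comp`) and ★ `reg336Cube_torus_of_pull`; §2 the member's letters (`levV1_memberIdx`, `sitesPerDir_memberIdx`,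
`mem_cubeClass396_memberIdx`); §3 ★★★ `reg335_reg336_T3_of_regPr`.
HONEST SCOPE.  Bookkeeping over landed objects; the analytic content is [B8] Prop. 6 = N05's theorem (consumed); nothing here discharges N05∕N06, proves EX, the crux,
V3∕R3, d = 4 or the mass gap; the re-TYPING of `ClassTransferT3` (definition lane) is the OWNER's act, not this file's.

References: T. Bałaban, CMP **99** (1985) 75–102 [Balaban1985RegularSpaces] ((1.33) p.82, p.98, Prop. 6 (1.135)–(1.138) p.99); CMP **99** (1985) 389–434
[Balaban1985BackgroundPropagators] ((3.35)–(3.36) p.396); CMP **102** (1985) 277–309 [Balaban1985Variational] ((2) p.278, (6) p.278); CMP **96** (1984) 223–250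
[Balaban1984PropagatorsII] ((2.1)–(2.4) p.224).
-/

set_option autoImplicit false

noncomputable section

open scoped Matrix.Norms.L2Operator
open NormedSpace
open Complex (I)

namespace Summit.QuantumFields.YangMills.Theorems.Prop7SectET3ClassTransfer

open Literature.MathematicalPhysics.QuantumFieldTheory.Balaban1983to89
open Literature.MathematicalPhysics.QuantumFieldTheory.Balaban1983to89.T3ContinuumYM3Torus
open Literature.MathematicalPhysics.QuantumFieldTheory.Balaban1983to89.T3PrintedRegularMinimiser (RegPr regPr_iff_inSpace)
open Literature.MathematicalPhysics.QuantumFieldTheory.Balaban1983to89.B10Eq27TorusAxialLog (transl transl_apply transl_add transl_add_e transl_sub_e transl_rel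
  transl_zero rel rel_apply rel_mem_Ioc rel_transl_of_mem rel_shift_of_le pull pull_apply toUField unitsField unitsField_mem_unitaryUnits)
open Literature.MathematicalPhysics.QuantumFieldTheory.Balaban1983to89.B6KLevelCensusIndexV1 (KIdx kGeo)
open Literature.MathematicalPhysics.QuantumFieldTheory.Balaban1983to89.B6GlobalChartV1 (PV toBox toBox_apply)
open Literature.MathematicalPhysics.QuantumFieldTheory.Balaban1983to89.B9BackgroundsKLevelV1 (torusCube levV1 IsCube396 cubeClass396 shiftsV1 reg335_iff reg336_iff)
open B6MultiLevelBoxOperator (bigSide N0)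
open B7Prop1Explicit (e e_apply)
open B7Prop2Explicit (unitaryUnits)
open B8Ineq132 (InAk)
open B8Eq133Hypotheses (shiftT byDir byDir_apply shiftT_apply)
open B9Eq39Adjoint (R covD covDstar curl curlη divP divPη fluct)
open B9Eq3117Current (gaugeTr)
open B9Eq335RegularityClasses (Reg335Cube Reg336Cube Reg335 Reg336)
open LatticeNorms (scaleLen)
open B9SupplySockB9P3ZdFrame (IsCube396Zd boxZd bigSideZd)
open B8Thm2SetupTorus (inSpace_univ_iff_inAk_pull)
open Summit.QuantumFields.YangMills.Theorems.Prop7SectET3Members (hd3 memberIdx memberIdx_k memberIdx_cf memberIdx_Mh)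
open Summit.QuantumFields.YangMills.Theorems.Prop7SectET3BgClass (bgT3 cfgV1OfT3 cfgV1OfT3_apply reg335_bgT3_iff reg336_bgT3_iff eta_memberIdx M_memberIdx)
open Summit.QuantumFields.YangMills.Theorems.Prop7SectET3ClassTransferZd (shiftT_symm_apply reg336Cube_zd_of_inAk)

/-! ## §1 Torus ↔ `ℤᵈ` bookkeeping and the DESCENT of (3.35)–(3.36) from a lifted cube to the torus cube -/

section Descent

variable {P : Params}

/-- The lift `c♯ := (val ∘ c)` of a torus site is a pre-image of it under `transl 0`. [folklore] -/
theorem transl_zero_lift (c : Site P 0) : transl (0 : Site P 0) (fun μ => ((c μ).val : ℤ)) = c := by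
  funext ν
  rw [transl_apply]
  show (0 : ZMod (P.sitesPerDir 0)) + (((c ν).val : ℤ) : ZMod (P.sitesPerDir 0)) = c ν
  rw [Int.cast_natCast, ZMod.natCast_zmod_val, zero_add]

/-- `0 + (c♯ + (x − c)) = x`: the chart `x ↦ c♯ + rel c x` inverts `transl 0`. [folklore] -/
theorem transl_zero_lift_add_rel (c x : Site P 0) : transl (0 : Site P 0) ((fun μ => ((c μ).val : ℤ)) + rel c x) = x := by
  rw [transl_add, transl_zero_lift, transl_rel]

/-- Inside a torus cube that fits twice in the period, the centred representative of `x − c` is the least one: `rel c x μ = (x μ − c μ).val`.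
[folklore] -/
theorem rel_eq_val_of_lt {c x : Site P 0} {S : ℕ} (hS : 2 * S + 2 ≤ P.sitesPerDir 0) (hx : x ∈ torusCube c S) (μ : Fin P.d) :
    rel c x μ = (((x μ - c μ).val : ℕ) : ℤ) := by
  rw [rel_apply, ZMod.valMinAbs_def_pos]
  have h1 : (x μ - c μ).val < S := hx μ
  have h2 : (x μ - c μ).val ≤ P.sitesPerDir 0 / 2 := by omega
  rw [if_pos h2]

/-- **No wrap-around, backward step**: if `−N < 2((x − c)_μ − 1)` then `(x − e_μ) − c = (x − c) − e_μ`. [folklore] -/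
theorem rel_unshift_of_lt (c x : Site P 0) (μ : Fin P.d) (h : -(P.sitesPerDir 0 : ℤ) < (rel c x μ - 1) * 2) :
    rel c (x.unshift μ) = rel c x - e μ := by
  have hx : x.unshift μ = transl c (rel c x - e μ) := by rw [transl_sub_e, transl_rel]
  rw [hx]
  refine rel_transl_of_mem c _ fun ν => ?_
  rw [Pi.sub_apply, e_apply]
  by_cases hν : ν = μ
  · subst hν
    rw [if_pos rfl]
    have h1 := rel_mem_Ioc c x ν
    exact ⟨h, by have := h1.2; linarith⟩
  · rw [if_neg hν, sub_zero]; exact rel_mem_Ioc c x ν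

variable {𝔸 : Type*} [NormedRing 𝔸] [NormedAlgebra ℂ 𝔸] [CompleteSpace 𝔸]

section Transport

variable {S₁ S₂ : Type*} {ι : Type*} (T₁ : ι → Equiv.Perm S₁) (T₂ : ι → Equiv.Perm S₂) (ψ : S₁ → S₂)

omit [NormedAlgebra ℂ 𝔸] [CompleteSpace 𝔸] in
/-- Transport of the FLAT covariant derivative along a local chart `ψ` intertwining the shifts at the point. [folklore] -/
theorem covD_one_comp {κ : ι} {x : S₁} (h : ψ (T₁ κ x) = T₂ κ (ψ x)) (f : S₂ → 𝔸) :
    covD T₁ (fun _ _ => (1 : 𝔸ˣ)) κ (fun y => f (ψ y)) x = covD T₂ (fun _ _ => (1 : 𝔸ˣ)) κ f (ψ x) := by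
  simp only [covD, R, h, Units.val_one, inv_one, one_mul, mul_one]

omit [CompleteSpace 𝔸] in
/-- Transport of the flat `η`-curl. [folklore] -/
theorem curlη_one_comp (η : ℝ) (A : ι → S₂ → 𝔸) {a b : ι} {x : S₁} (ha : ψ (T₁ a x) = T₂ a (ψ x)) (hb : ψ (T₁ b x) = T₂ b (ψ x)) :
    curlη T₁ (fun _ _ => (1 : 𝔸ˣ)) η (fun κ y => A κ (ψ y)) a b x = curlη T₂ (fun _ _ => (1 : 𝔸ˣ)) η A a b (ψ x) := by
  simp only [curlη, curl]
  rw [covD_one_comp T₁ T₂ ψ ha (A b), covD_one_comp T₁ T₂ ψ hb (A a)]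

omit [CompleteSpace 𝔸] in
/-- Transport of the flat `∂^{η*}∂^η` along a local chart intertwining the forward shifts at `x` and at the `T_ν⁻¹x`, and the backward shifts at `x`.
[folklore] -/
theorem divPη_curlη_one_comp [Fintype ι] [LinearOrder ι] (η : ℝ) (A : ι → S₂ → 𝔸) {μ : ι} {x : S₁}
    (h0 : ∀ a, ψ (T₁ a x) = T₂ a (ψ x)) (h1 : ∀ ν, ψ ((T₁ ν).symm x) = (T₂ ν).symm (ψ x))
    (h2 : ∀ ν a, ψ (T₁ a ((T₁ ν).symm x)) = T₂ a (ψ ((T₁ ν).symm x))) :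
    divPη T₁ (fun _ _ => (1 : 𝔸ˣ)) η (curlη T₁ (fun _ _ => (1 : 𝔸ˣ)) η (fun κ y => A κ (ψ y))) μ x =
      divPη T₂ (fun _ _ => (1 : 𝔸ˣ)) η (curlη T₂ (fun _ _ => (1 : 𝔸ˣ)) η A) μ (ψ x) := by
  have hterm : ∀ ν a b, covDstar T₁ (fun _ _ => (1 : 𝔸ˣ)) ν (curlη T₁ (fun _ _ => (1 : 𝔸ˣ)) η (fun κ y => A κ (ψ y)) a b) x =
      covDstar T₂ (fun _ _ => (1 : 𝔸ˣ)) ν (curlη T₂ (fun _ _ => (1 : 𝔸ˣ)) η A a b) (ψ x) := by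
    intro ν a b
    simp only [covDstar, R, Units.val_one, inv_one, one_mul, mul_one]
    rw [curlη_one_comp T₁ T₂ ψ η A (h2 ν a) (h2 ν b), h1 ν, curlη_one_comp T₁ T₂ ψ η A (h0 a) (h0 b)]
  simp only [divPη, divP, hterm]

end Transport

/-- ★ **DESCENT OF (3.35)–(3.36) FROM A LIFTED CUBE TO THE TORUS CUBE.**  Let `V` be a bond field on the torus `Site P 0`, `c` a torus site with lift
`c♯ = val ∘ c`, and `S` a side with `2S + 2 ≤ N` (`N` the period).  If the periodic pullback `pull V 0` (read in [4]'s letter order `byDir`) satisfies r06's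
`Reg336Cube (shiftT P.d) … η (boxZd c♯ S) ξ C` on the `ℤᵈ` cube over `c♯`, then `V` (read as `μ x ↦ V ⟨x, μ⟩`, def-Y's `CfgV1` letter order) satisfies
`Reg336Cube (shiftsV1 P) … η (torusCube c S) ξ C`: the gauge transformation and the one-form are read through the chart `x ↦ c♯ + rel c x` (a bijection of the
torus cube onto the lifted cube which intertwines the ±1 steps of the (3.36) stencil — no wrap-around since the stencil spans `S + 2 ≤ N∕2 + 1` sites).
[cite: Balaban1985BackgroundPropagators, (3.35)–(3.36) p.396; Balaban1985Averaging, (9) p.18 (periodic extension)] -/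
theorem reg336Cube_torus_of_pull (V : PBond P 0 → 𝔸ˣ) (c : Site P 0) {S : ℕ} (hS : 2 * S + 2 ≤ P.sitesPerDir 0) {η ξ C : ℝ}
    (h : Reg336Cube (shiftT P.d) (byDir (pull V 0)) η (boxZd (fun μ => ((c μ).val : ℤ)) S) ξ C) :
    Reg336Cube (shiftsV1 P) (fun μ x => V ⟨x, μ⟩) η (torusCube c S) ξ C := by
  classical
  obtain ⟨u, A, hu, hg, hA, hD, h36⟩ := h
  -- the chart `x ↦ c♯ + (x − c)`
  set cs : B7Prop1Explicit.Site P.d := fun μ => ((c μ).val : ℤ) with hcs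
  set φ : Site P 0 → B7Prop1Explicit.Site P.d := fun x => cs + rel c x with hφ
  have hφt : ∀ x, transl 0 (φ x) = x := fun x => transl_zero_lift_add_rel c x
  have hSN : (2 * S + 2 : ℤ) ≤ (P.sitesPerDir 0 : ℤ) := by exact_mod_cast hS
  -- relative coordinates inside the cube
  have hrel : ∀ x ∈ torusCube c S, ∀ μ, 0 ≤ rel c x μ ∧ rel c x μ + 1 ≤ S := fun x hx μ => by
    rw [rel_eq_val_of_lt hS hx μ]
    have h1 : (x μ - c μ).val < S := hx μ
    exact ⟨by positivity, by exact_mod_cast h1⟩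
  have hmem : ∀ x ∈ torusCube c S, φ x ∈ boxZd cs S := fun x hx μ => by
    obtain ⟨h1, h2⟩ := hrel x hx μ
    simp only [hφ, Pi.add_apply]
    exact ⟨by linarith, by linarith⟩
  -- no wrap-around: forward steps from the `(−1)`-collar of the cube, backward steps from the cube
  have hfw : ∀ x : Site P 0, (∀ μ, -1 ≤ rel c x μ ∧ rel c x μ + 1 ≤ S) → ∀ κ, φ (x.shift κ) = φ x + e κ := fun x hx κ => by
    have hk : (rel c x κ + 1) * 2 ≤ (P.sitesPerDir 0 : ℤ) := by have := (hx κ).2; linarith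
    simp only [hφ]
    rw [rel_shift_of_le c x κ hk, add_assoc]
  have hbw : ∀ x ∈ torusCube c S, ∀ ν, φ (x.unshift ν) = φ x - e ν := fun x hx ν => by
    have h0 := (hrel x hx ν).1
    have h1 := (hrel x hx ν).2
    have hk : -(P.sitesPerDir 0 : ℤ) < (rel c x ν - 1) * 2 := by linarith
    simp only [hφ]
    rw [rel_unshift_of_lt c x ν hk, add_sub_assoc]
  have hcube : ∀ x ∈ torusCube c S, ∀ μ, -1 ≤ rel c x μ ∧ rel c x μ + 1 ≤ S := fun x hx μ =>
    ⟨by linarith [(hrel x hx μ).1], (hrel x hx μ).2⟩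
  have hcube' : ∀ x ∈ torusCube c S, ∀ ν μ, -1 ≤ rel c (x.unshift ν) μ ∧ rel c (x.unshift ν) μ + 1 ≤ S := fun x hx ν μ => by
    have hk : -(P.sitesPerDir 0 : ℤ) < (rel c x ν - 1) * 2 := by linarith [(hrel x hx ν).1, (hrel x hx ν).2]
    rw [rel_unshift_of_lt c x ν hk, Pi.sub_apply, e_apply]
    obtain ⟨h1, h2⟩ := hrel x hx μ
    split_ifs <;> constructor <;> linarith
  -- the intertwinings in the `Equiv.Perm` letters of both sides
  have i0 : ∀ x ∈ torusCube c S, ∀ a, φ (shiftsV1 P a x) = shiftT P.d a (φ x) := fun x hx a => by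
    rw [shiftT_apply]; exact hfw x (hcube x hx) a
  have i1 : ∀ x ∈ torusCube c S, ∀ ν, φ ((shiftsV1 P ν).symm x) = (shiftT P.d ν).symm (φ x) := fun x hx ν => by
    rw [shiftT_symm_apply]; exact hbw x hx ν
  have i2 : ∀ x ∈ torusCube c S, ∀ ν a, φ (shiftsV1 P a ((shiftsV1 P ν).symm x)) = shiftT P.d a (φ ((shiftsV1 P ν).symm x)) :=
    fun x hx ν a => by
    rw [shiftT_apply]; exact hfw _ (hcube' x hx ν) a
  refine ⟨fun x => u (φ x), fun κ x => A κ (φ x), fun z hz => hu (φ z) (hmem z hz), ?_, fun κ z hz => hA κ (φ z) (hmem z hz), ?_, ?_⟩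
  · -- `U^u = e^{iηA}` on the bonds of the torus cube
    intro κ z hz
    have h1 := hg κ (φ z) (hmem z hz)
    have h2 : gaugeTr (shiftT P.d) u (byDir (pull V 0)) κ (φ z) = u (φ z) * V ⟨z, κ⟩ * (u (φ z + e κ))⁻¹ := by
      simp only [gaugeTr, byDir_apply, pull_apply, shiftT_apply, hφt]
    have h3 : gaugeTr (shiftsV1 P) (fun x => u (φ x)) (fun μ x => V ⟨x, μ⟩) κ z = u (φ z) * V ⟨z, κ⟩ * (u (φ z + e κ))⁻¹ := by
      simp only [gaugeTr]
      rw [← shiftT_apply, ← i0 z hz κ]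
    rw [h3, ← h2, h1]
    rfl
  · -- `|∇^ηA|`
    intro κ ν z hz
    have h1 := hD κ ν (φ z) (hmem z hz)
    have h2 : covD (shiftsV1 P) (fun _ _ => (1 : 𝔸ˣ)) κ ((fun κ x => A κ (φ x)) ν) z = covD (shiftT P.d) (fun _ _ => (1 : 𝔸ˣ)) κ (A ν) (φ z) :=
      covD_one_comp (shiftsV1 P) (shiftT P.d) φ (i0 z hz κ) (A ν)
    rw [h2]
    exact h1
  · -- `|∂^{η*}∂^ηA|`
    intro μ z hz
    have h1 := h36 μ (φ z) (hmem z hz)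
    rw [divPη_curlη_one_comp (shiftsV1 P) (shiftT P.d) φ η A (i0 z hz) (i1 z hz) (i2 z hz)]
    exact h1

/-- The (3.35) half of the descent (r06's `Reg336Cube.reg335Cube`). [cite: Balaban1985BackgroundPropagators, (3.35)–(3.36) p.396] -/
theorem reg335Cube_torus_of_pull (V : PBond P 0 → 𝔸ˣ) (c : Site P 0) {S : ℕ} (hS : 2 * S + 2 ≤ P.sitesPerDir 0) {η ξ C : ℝ}
    (h : Reg336Cube (shiftT P.d) (byDir (pull V 0)) η (boxZd (fun μ => ((c μ).val : ℤ)) S) ξ C) :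
    Reg335Cube (shiftsV1 P) (fun μ x => V ⟨x, μ⟩) η (torusCube c S) ξ C :=
  (reg336Cube_torus_of_pull V c hS h).reg335Cube _ _

end Descent

/-! ## §2 The member's letters: one class index `K − n`, the period, the class cubes -/

section Member

open Summit.QuantumFields.YangMills.Theorems.Prop7SectET3Members (tdWhole hN_chart hLP_chart hkw)
open Summit.QuantumFields.YangMills.Theorems.FlatPortChart (levV ofBox ofBox_toBox levV_le le_levV_iff)
open Summit.QuantumFields.YangMills.Theorems.FlatCubeOpsTextWhole (inOm_whole_iff)
open B6SectADomainsV1 (Domains)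

variable {ℓ : ℕ} {hL : Odd (ℓ + 1) ∧ 1 < ℓ + 1}

/-- **EVERY SITE OF THE MEMBER HAS LEVEL `K − n`**: the member's domain datum is the PADDED chart of the pure-small-field family (`Ω_j = T` for `j ≤ K − n`, the top level
`K − n + 1` EMPTY), so `levV1 (memberIdx …) x = levV (Domains.whole (K − n)) x = K − n`. [cite: Balaban1984PropagatorsII, (2.1)–(2.4) p.224 («some domains Ω_j are equal to T_η … or are empty»)] -/
theorem levV1_memberIdx (hℓ : 4 ≤ ℓ) (m : ℕ) (hm : 1 ≤ m) (n K a' R : ℕ) (hk1 : 1 ≤ K - n) (hsize : a' + 3 ≤ m + n) (hM8 : 8 ≤ (ℓ + 1) ^ a')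
    (hR2 : 2 * (ℓ + 1) ^ 2 ≤ R) (x : Site (PV 2 ℓ m K hd3 hL) 0) :
    levV1 (memberIdx ℓ hL hℓ m hm n K a' R hk1 hsize hM8 hR2) x = K - n := by
  have key : ∀ y : Site (PV 2 ℓ m K hd3 hL) 0, levV (Domains.whole (K - n) (hkw ℓ hL m n K)) y = K - n := fun y =>
    le_antisymm (levV_le _ _) ((le_levV_iff (Domains.whole (K - n) (hkw ℓ hL m n K)) le_rfl y).2 ((inOm_whole_iff (hkw ℓ hL m n K) (K - n) y).2 le_rfl))
  show levV (Domains.whole (K - n) (hkw ℓ hL m n K)) (ofBox (toBox (memberIdx ℓ hL hℓ m hm n K a' R hk1 hsize hM8 hR2).hN x : Fin (2 + 1) → ℤ)) = K - n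
  exact key _

/-- **THE PERIOD OF THE MEMBER TORUS IN TERMS OF THE BIG BLOCKS**: `N = bigSide·(2·L^{m+n−1−a'})` (p1's chart `N₀ = L^{K−n}·L·M_h·P′`). [cite: Balaban1984PropagatorsII, (2.1) p.224 (dictionary)] -/
theorem sitesPerDir_memberIdx (hℓ : 4 ≤ ℓ) (m n K a' : ℕ) (hk1 : 1 ≤ K - n) (hsize : a' + 3 ≤ m + n) :
    (PV 2 ℓ m K hd3 hL).sitesPerDir 0 = bigSide ℓ ((ℓ + 1) ^ a') (K - n) * (2 * (ℓ + 1) ^ (m + n - 1 - a')) := by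
  have h := hN_chart ℓ hL hℓ m n K a' hk1 hsize 0
  rw [← h]
  simp only [N0, bigSide]
  ring

/-- **THE TORUS CLASS CUBES FIT TWICE (AND MORE) IN THE PERIOD**: `2·(n'·bigSide) + 2 ≤ N` for `n' ≤ 10` (`N∕(10·bigSide) = L^{m+n−1−a'}∕5 ≥ 5`). [cite: Balaban1985BackgroundPropagators, p.396 («O(1) will mean a number ≤ 10»)] -/
theorem two_mul_side_add_two_le (hℓ : 4 ≤ ℓ) (m n K a' : ℕ) (hk1 : 1 ≤ K - n) (hsize : a' + 3 ≤ m + n) {n' : ℕ} (hn' : n' ≤ 10) :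
    2 * (n' * bigSide ℓ ((ℓ + 1) ^ a') (K - n)) + 2 ≤ (PV 2 ℓ m K hd3 hL).sitesPerDir 0 := by
  rw [sitesPerDir_memberIdx hℓ m n K a' hk1 hsize]
  have hB : 1 ≤ bigSide ℓ ((ℓ + 1) ^ a') (K - n) := by
    unfold bigSide
    exact Nat.one_le_iff_ne_zero.mpr (Nat.mul_ne_zero (pow_ne_zero _ (by omega)) (pow_ne_zero _ (by omega)))
  have he : 2 ≤ m + n - 1 - a' := by omega
  have hL5 : 5 ≤ ℓ + 1 := by omega
  have hpow : 25 ≤ (ℓ + 1) ^ (m + n - 1 - a') :=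
    calc 25 = 5 ^ 2 := by norm_num
      _ ≤ (ℓ + 1) ^ 2 := Nat.pow_le_pow_left hL5 2
      _ ≤ (ℓ + 1) ^ (m + n - 1 - a') := Nat.pow_le_pow_right (by omega) he
  set B := bigSide ℓ ((ℓ + 1) ^ a') (K - n)
  set E := (ℓ + 1) ^ (m + n - 1 - a')
  nlinarith

/-- **THE MEMBER'S CUBE CLASS HAS ONE INDEX, `K − n`**, and consists of class torus cubes of that index. [cite: Balaban1985BackgroundPropagators, p.396 (the cube class)] -/
theorem mem_cubeClass396_memberIdx (hℓ : 4 ≤ ℓ) (m : ℕ) (hm : 1 ≤ m) (n K a' R : ℕ) (hk1 : 1 ≤ K - n) (hsize : a' + 3 ≤ m + n) (hM8 : 8 ≤ (ℓ + 1) ^ a')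
    (hR2 : 2 * (ℓ + 1) ^ 2 ≤ R) {q : Set (Site (PV 2 ℓ m K hd3 hL) 0) × ℕ} (hq : q ∈ cubeClass396 (memberIdx ℓ hL hℓ m hm n K a' R hk1 hsize hM8 hR2)) :
    q.2 = K - n ∧ IsCube396 (memberIdx ℓ hL hℓ m hm n K a' R hk1 hsize hM8 hR2) q.1 (K - n) := by
  obtain ⟨-, -, hcube, -, x, -, hx⟩ := hq
  rw [levV1_memberIdx] at hx
  rw [← hx] at hcube
  exact ⟨hx.symm, hcube⟩

end Member

/-! ## §3 The class-transfer row in its print-faithful shape -/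

section Row

variable (ℓ : ℕ) (hL : Odd (ℓ + 1) ∧ 1 < ℓ + 1)

/-- ★★★ **THE CLASS-TRANSFER ROW «𝔘_k(α₀) ⊂ (3.35) ∧ (3.36)» AT THE T³ MEMBER OF RECORD, IN PRINT'S REGIME `M·α₀ ≤ a₅`** ([Balaban1985RegularSpaces] (1.33) second clause
= Prop. 6 p.99 «for α₀ sufficiently small we have proved the regularity condition (3.35)»).  For odd `L = ℓ + 1 ≥ 5` there are `c35, a₅ > 0` such that for every member
`memberIdx ℓ hL hℓ m hm n K a' R …` (big blocks `M = L·L^{a'}`, height `K − n ≥ 1`), every `α₀ > 0` with `M·α₀ ≤ a₅`, every `SU(2)` field `U₀` in print's regular space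
`RegPr ⟨ℓ+1, hL, m, hm⟩ n K α₀` ([Balaban1985Variational] (2)∕(6): plaquettes `< α₀L^{−2(K−n)}`, covariant divergence `< α₀L^{−3(K−n)}`) and every constant `c ≥ c35`,
the V1 reading `cfgV1OfT3 U₀` lies in def-Y's classes (3.35) AND (3.36) of the member with threshold constant `c` (`(bgT3 (memberIdx …)).Reg335 c α₀` ∧ `.Reg336 c α₀`).
Route: (R1) periodic pullback `∈ 𝔄_{K−n}(ℤ³, α₀)` (`regPr_iff_inSpace`, `inSpace_univ_iff_inAk_pull`); (R2) the member's class cubes are `torusCube c (n'·bigSide)` of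
the one index `K − n` (§2), lifting to p. 396 class cubes of the all-torus `ℤ³` datum; (R3) the companion's `reg336Cube_zd_of_inAk` ([B8] Prop. 6 by
`prop6Printed_zdCubP_γ_holds`) on the lift at scale `L^{K−n}·L^{−(K−n)} = 1`, then §1's descent.  This is the BODY of the re-typed row (BG-336)′ proposed in
`pub/ym-inputs/CLASS-TRANSFER-LOCATE-p06.md`; the typed row `ClassTransferT3` (∀ α₀) is NOT claimed.  Nothing of print asserted; N05∕N06 not discharged here.
[cite: Balaban1985RegularSpaces, (1.33) p.82, Prop. 6 (1.135)–(1.138) p.99, p.98; Balaban1985BackgroundPropagators, (3.35)–(3.36) p.396; Balaban1985Variational, (2) p.278] -/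
theorem reg335_reg336_T3_of_regPr (hℓ4 : 4 ≤ ℓ) :
    ∃ c35 a₅ : ℝ, 0 < c35 ∧ 0 < a₅ ∧
      ∀ (hℓ : 4 ≤ ℓ) (m : ℕ) (hm : 1 ≤ m) (n K a' R : ℕ) (hk1 : 1 ≤ K - n) (hsize : a' + 3 ≤ m + n) (hM8 : 8 ≤ (ℓ + 1) ^ a')
        (hR2 : 2 * (ℓ + 1) ^ 2 ≤ R) (α₀ : ℝ), 0 < α₀ → ((ℓ + 1 : ℕ) : ℝ) * (((ℓ + 1) ^ a' : ℕ) : ℝ) * α₀ ≤ a₅ →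
        ∀ U₀ : GaugeField (PV 2 ℓ m K hd3 hL) 0 (Matrix.specialUnitaryGroup (Fin 2) ℂ),
          RegPr (⟨ℓ + 1, hL, m, hm⟩ : T3Family) n K α₀ U₀ → ∀ c : ℝ, c35 ≤ c →
            (bgT3 (memberIdx ℓ hL hℓ m hm n K a' R hk1 hsize hM8 hR2)).Reg335 c α₀ (cfgV1OfT3 U₀) ∧
              (bgT3 (memberIdx ℓ hL hℓ m hm n K a' R hk1 hsize hM8 hR2)).Reg336 c α₀ (cfgV1OfT3 U₀) := by
  classical
  letI : CStarAlgebra (Matrix (Fin 2) (Fin 2) ℂ) := {}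
  have hL5 : 5 ≤ ℓ + 1 := by omega
  obtain ⟨c35, c₆, hc35, hc₆, H⟩ := reg336Cube_zd_of_inAk (𝔸 := Matrix (Fin 2) (Fin 2) ℂ) (d := 2 + 1) (by norm_num) hL5 hL.1
  refine ⟨c35, c₆, hc35, hc₆, ?_⟩
  intro hℓ m hm n K a' R hk1 hsize hM8 hR2 α₀ hα₀ hMα U₀ hreg c hc
  set i := memberIdx ℓ hL hℓ m hm n K a' R hk1 hsize hM8 hR2 with hi
  suffices h336 : (bgT3 i).Reg336 c α₀ (cfgV1OfT3 U₀) from ⟨B9BackgroundsKLevelV1.reg336_reg335 i h336, h336⟩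
  rw [reg336_bgT3_iff]
  intro q hq
  obtain ⟨hq2, c₀, n', hn1, hn10, hdiv, -, hQ⟩ := mem_cubeClass396_memberIdx hℓ m hm n K a' R hk1 hsize hM8 hR2 hq
  -- letters of the member
  have hη : (kGeo i).eta = ((((ℓ + 1 : ℕ) : ℝ)) ^ (K - n))⁻¹ := eta_memberIdx hℓ m hm n K a' R hk1 hsize hM8 hR2
  have hηpos : 0 < (kGeo i).eta := (B9BackgroundsKLevelV1.eta_pos_L_one_le_M_pos i).1
  have hM : (kGeo i).M = ((ℓ + 1 : ℕ) : ℝ) * (((ℓ + 1) ^ a' : ℕ) : ℝ) := M_memberIdx hℓ m hm n K a' R hk1 hsize hM8 hR2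
  have hMnat : (kGeo i).M = ((((ℓ + 1) * (ℓ + 1) ^ a' : ℕ)) : ℝ) := by rw [hM]; push_cast; ring
  have hM1 : (1 : ℝ) ≤ (kGeo i).M := by
    rw [hMnat]
    exact_mod_cast Nat.one_le_iff_ne_zero.mpr (Nat.mul_ne_zero (by omega) (pow_ne_zero _ (by omega)))
  have hMα' : (kGeo i).M * α₀ ≤ c₆ := by rw [hM]; exact hMα
  have hMh : i.Mh = (ℓ + 1) ^ a' := rfl
  -- (R1): the periodic pullback lies in `𝔄_{K−n}(ℤ³, α₀)`
  set V : PBond (PV 2 ℓ m K hd3 hL) 0 → (Matrix (Fin 2) (Fin 2) ℂ)ˣ := unitsField (toUField U₀) with hV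
  have hIn : InAk (ℓ + 1) (K - n) (kGeo i).eta α₀ (fun _ : ℕ => (Set.univ : Set (B7Prop1Explicit.Site (2 + 1)))) (pull V 0) := by
    have h1 := (regPr_iff_inSpace (F := (⟨ℓ + 1, hL, m, hm⟩ : T3Family)) (n := n) (K := K) hα₀.le U₀).1 hreg
    have h2 := (inSpace_univ_iff_inAk_pull (P := PV 2 ℓ m K hd3 hL) (K - n) α₀ ((((ℓ + 1 : ℕ) : ℝ))⁻¹ ^ (K - n)) (toUField U₀)).1 h1
    rw [hη, ← inv_pow]
    exact h2
  have hVu : ∀ x κ, pull V 0 x κ ∈ unitaryUnits (Matrix (Fin 2) (Fin 2) ℂ) := fun x κ => unitsField_mem_unitaryUnits (toUField U₀) _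
  -- (R2): the lift of the class cube is a p. 396 class cube of the all-torus `ℤ³` datum
  set S : ℕ := n' * bigSide ℓ ((ℓ + 1) ^ a') (K - n) with hS
  have hside : bigSideZd (kGeo i).M (ℓ + 1) (K - n) = bigSide ℓ ((ℓ + 1) ^ a') (K - n) := by
    rw [bigSideZd, hMnat, Nat.ceil_natCast, bigSide]
    ring
  have hZd : IsCube396Zd (kGeo i).M (ℓ + 1) (K - n) (boxZd (fun μ => (((c₀ μ).val : ℕ) : ℤ)) S) := by
    refine ⟨fun μ => (((c₀ μ).val : ℕ) : ℤ), n', hn1, hn10, fun μ => ?_, by rw [hside]⟩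
    rw [hside]
    have h := hdiv μ
    rw [hMh] at h
    show ((bigSide ℓ ((ℓ + 1) ^ a') (K - n) : ℕ) : ℤ) ∣ (((c₀ μ).val : ℕ) : ℤ)
    exact_mod_cast h
  -- (R3): Proposition 6 on the lift, then the descent
  have hZ := H (kGeo i).eta hηpos (K - n) hk1 (kGeo i).M hM1 _ hZd (pull V 0) hVu α₀ hα₀ hMα' hIn c hc
  have hNS : 2 * S + 2 ≤ (PV 2 ℓ m K hd3 hL).sitesPerDir 0 := two_mul_side_add_two_le hℓ m n K a' hk1 hsize hn10
  have hT := reg336Cube_torus_of_pull V c₀ hNS hZ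
  have hq' : q = (torusCube c₀ S, K - n) := Prod.ext hQ hq2
  rw [hq']
  exact hT

end Row

end Summit.QuantumFields.YangMills.Theorems.Prop7SectET3ClassTransfer

end
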